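import Literature.NumberTheory.LFunctions.NymanBeurlingVectorsHigherOrthogonal
import Literature.NumberTheory.LFunctions.NymanBeurlingVectorsHigherAsymptotics
import Literature.Barriers.RiemannHypothesis.NymanBeurlingObstructionsProofs
import Literature.Barriers.RiemannHypothesis.NymanBeurlingObstructionsBDBLSProofs
import Mathlib.LinearAlgebra.Lagrange
import HarnessLib

/-!
# Burnol 2002, Theorem 1.3 — proved: `liminf_{λ→0} D(λ)√(log(1/λ)) ≥ √(∑_ρ m_ρ²/|ρ|²)` (zeros weighted by the square of their multiplicity)

Barrier catalogue `Literature/Barriers/RiemannHypothesis/`, companion ("Proofs") file of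
`NymanBeurlingObstructions.lean`. It discharges the named fact
`Literature.Barriers.RiemannHypothesis.Burnol2002_thm1_3` — J.-F. Burnol, Adv. Math. 170 (2002),
Theorem 1.3: "`liminf_{λ→0} D(λ)√(log(1/λ)) ≥ √(∑_ρ m_ρ²/|ρ|²)`. So the zeros are counted according
to the square of their multiplicities." — as `Literature.Barriers.RiemannHypothesis.Burnol2002_thm1_3_holds`,
fully proved (no named fact assumed; axioms `propext`, `Classical.choice`, `Quot.sound`).

## Source and printed proof (arXiv:math/0103058)

`K = L²(]0,∞[, dt)`, `χ = 𝟙_{]0,1]}`, `𝓑_λ` the span of `t ↦ ρ(θ/t)`, `λ ≤ θ ≤ 1`,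
`D(λ) = inf_{f ∈ 𝓑_λ} ‖χ - f‖`. "If the Riemann Hypothesis fails this result is true but trivial as
the left-hand side then takes the value `+∞`" (Thm. 1.1, Nyman–Beurling). Under RH: the unitary
`1 - M` (`M` the Hardy averaging operator) turns `(χ, 𝓑_λ)` into `(χ₁, 𝓒_λ)` (§4); to each zero
`ρ` and `0 ≤ k < m_ρ` Burnol attaches `Y^λ_{ρ,k} = lim_{w→ρ} V⁻¹Q_λV(ψ_{w,k})`,
`ψ_{w,k} = (log(1/t))^k t^{-w} χ(t)` (Thm. 4.2), orthogonal to `𝓒_λ` exactly when `k < m_ρ`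
(Cor. 4.3), and `X^λ_{ρ,k} = (log(1/λ))^{-1/2-k} Y^λ_{ρ,k}` (Def. 5.1); Thm. 5.2:
`(X^λ_{ρ₁,k}, X^λ_{ρ₂,l}) → 0` (`ρ₁ ≠ ρ₂`), `(X^λ_{ρ,k}, X^λ_{ρ,l}) → 1/(k+l+1)`; Thm. 5.3:
`√(log(1/λ))(χ₁, X^λ_{ρ,k}) → 0` (`k ≥ 1`), `→ (ρ-1)/ρ²` (`k = 0`); Thm. 5.4 (= 1.3): for a finite
set `R` of zeros `D(λ) ≥ ‖P_{H_R} χ₁‖`, "given by a well-known formula involving the inverse of the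
Gram matrix … the Gram matrix converges to diagonal blocks, one for each zero, given by Cauchy
matrices of sizes `m_ρ × m_ρ`. From Cauchy we know that the top-left element of the inverse matrix
is `m_ρ²`", whence `L·D(λ)² ≳ ∑_{ρ ∈ R} m_ρ²/|ρ|²`.

## The argument here (same architecture; the vectors realised on the Mellin side)

1. (`hilbert_inverse_first_column`) Cauchy: the first column `u = H_m⁻¹e₀` of the inverse Hilbert
   matrix `H_m = (1/(k+l+1))` has `u₀ = m²` (partial fractions by Lagrange interpolation, Mathlib
   `Lagrange.eval_interpolate_not_at_node`).
2. (`genError_ge_of_orthogonal`) Duality: if `y ∈ L²(0,∞)` is orthogonal to every `{1/(at)}`,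
   `1 ≤ a ≤ 1/λ`, then `‖χ - f‖ ≥ |(χ,y)|/‖y‖` for every admissible `f` (Cauchy–Schwarz).
3. (`BurnolVectors.burnolX`, `burnolVectors_spec`) The vectors: with the Mellin data
   `K_k = burnolKk ρ k λ` of `Literature/NumberTheory/LFunctions/NymanBeurlingVectorsHigher*.lean`
   (orthogonality `integral_mellin_fract_mul_burnolKk_eq_zero`, pairing and Gram asymptotics),
   `X^λ_{ρ,k} = c · 𝓜⁻¹(conj ∘ K_k)` with `c = ε_ρ(-1)^k/(√w(γ) L^k √L)`, `ε_ρ = -conj(ρ)³/|ρ|³`; the six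
   properties of Def. 5.1/Cor. 4.3/Thm. 5.2/Thm. 5.3 (in the `(χ, 𝓑_λ)` picture) follow by the
   Parseval pairing and Plancherel identity for `𝓜⁻¹` of the tree (`integral_mul_conj_mellinInv`,
   `integral_norm_sq_mellinInv`, polarised as `integral_mellinInv_mul_conj_mellinInv`).
4. (`eventually_nbDist_ge_of_finset`) For a finite set `T` of zeros on the line, with
   `y_λ = ∑_{ρ ∈ T} ∑_{k<m_ρ} ((ρ-1)/ρ²) u^{(m_ρ)}_k X^λ_{ρ,k}`: `√L(χ, y_λ) → ∑_T m_ρ²/|ρ|²` and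
   `‖y_λ‖² → ∑_T m_ρ²/|ρ|²`, so `L·D(λ)² ≥ ∑_T m_ρ²/|ρ|² - o(1)`.
5. (`Burnol2002_thm1_3_holds`) A zero off the line bounds `D(λ)` below
   (`genError_ge_of_zero_off_line`, the non-RH case); otherwise all nontrivial zeros are on the line
   and the `tsum` over the distinct zeros is approached by finite sub-sums when summable, `0` if not.

## References

* [Burnol2002] J.-F. Burnol, *A lower bound in an approximation problem involving the zeros of the
  Riemann zeta function*, Adv. Math. 170 (2002), 56–70; arXiv:math/0103058 (read in full: §1
  Thms. 1.1–1.4, §2 Thm. 2.1, §3, §4 Prop. 4.1–Thm. 4.8, §5 Def. 5.1–Thm. 5.4).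
* [BDBLS2000] L. Báez-Duarte, M. Balazard, B. Landreau, E. Saias, *Notes sur la fonction ζ de
  Riemann, 3*, Adv. Math. 149 (2000), 130–144 (Thm. 1.2 = Burnol's Thm. 1.2; through Burnol).
-/

noncomputable section

open MeasureTheory Filter Set Complex Finset Polynomial
open scoped Real Topology ComplexConjugate

namespace Literature.Barriers.RiemannHypothesis

open Literature.NumberTheory.LFunctions Literature.NumberTheory.LFunctions.BurnolVectors
  Literature.NumberTheory.LFunctions.BaezDuarteU

namespace Burnol2002Assembly

/-! ## 1. Cauchy's evaluation: the top-left entry of the inverse Hilbert matrix is `m²` -/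

/-- **Cauchy: the top-left entry of the inverse of the `m × m` Hilbert (Cauchy) matrix
`H_m = (1/(k+l+1))_{0 ≤ k,l < m}` is `m²`** ("From Cauchy we know that the top-left element of the
inverse matrix is `m_ρ²`"), stated through the first column `u = H_m⁻¹ e₀` with `m = n + 1`: there
is `u` with `∑_{l<m} u_l/(k+l+1) = [k = 0]` for `k < m` and `u₀ = m²`. Proof: partial fractions of
`(-1)^n (n+1) ∏_{j=1}^{n}(x-j) / ∏_{i=1}^{n+1}(x+i)` via Lagrange interpolation at the nodes
`-1, …, -(n+1)` (Mathlib `Lagrange.eval_interpolate_not_at_node`). [cite: Burnol2002, §2 and Thm. 5.4 (proof)] -/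
theorem hilbert_inverse_first_column (n : ℕ) :
    ∃ u : ℕ → ℝ, u 0 = ((n : ℝ) + 1) ^ 2 ∧
      ∀ k : ℕ, k < n + 1 →
        ∑ l ∈ Finset.range (n + 1), u l / ((k : ℝ) + l + 1) = if k = 0 then 1 else 0 := by
  classical
  set s : Finset ℕ := Finset.range (n + 1) with hs
  set v : ℕ → ℝ := fun i ↦ -((i : ℝ) + 1) with hv
  set N : ℝ[X] := C ((-1 : ℝ) ^ n * ((n : ℝ) + 1)) *
    ∏ j ∈ Finset.range n, (X - C ((j : ℝ) + 1)) with hN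
  have hvs : Set.InjOn v s := by
    intro i _ j _ h
    simp only [hv, neg_inj, add_left_inj, Nat.cast_inj] at h
    exact h
  have hcoef : ((-1 : ℝ) ^ n * ((n : ℝ) + 1)) ≠ 0 := by positivity
  have hdeg : N.degree < #s := by
    rw [hs, Finset.card_range, hN, degree_C_mul hcoef, degree_prod]
    simp only [degree_X_sub_C, Finset.sum_const, Finset.card_range, nsmul_eq_mul, mul_one]
    exact_mod_cast Nat.lt_succ_self n
  have hinterp : N = Lagrange.interpolate s v (fun i ↦ N.eval (v i)) := Lagrange.eq_interpolate hvs hdeg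
  -- evaluation of `N`
  have hNeval : ∀ x : ℝ, N.eval x = (-1 : ℝ) ^ n * ((n : ℝ) + 1) *
      ∏ j ∈ Finset.range n, (x - ((j : ℝ) + 1)) := by
    intro x
    simp only [hN, eval_mul, eval_C, eval_prod, eval_sub, eval_X]
  refine ⟨fun i ↦ Lagrange.nodalWeight s v i * N.eval (v i), ?_, ?_⟩
  · -- `u 0 = (n+1)²`
    have hw : Lagrange.nodalWeight s v 0 = ((n.factorial : ℝ))⁻¹ := by
      rw [Lagrange.nodalWeight]
      have h1 : ∏ j ∈ s.erase 0, (v 0 - v j)⁻¹ = ∏ j ∈ s.erase 0, (if j = 0 then 1 else ((j : ℝ))⁻¹) := by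
        refine Finset.prod_congr rfl fun j hj ↦ ?_
        have hj0 : j ≠ 0 := (Finset.mem_erase.1 hj).1
        simp only [hv, if_neg hj0]
        congr 1
        ring
      rw [h1, Finset.prod_erase _ (by simp), hs, Finset.prod_range_succ']
      simp only [Nat.succ_ne_zero, if_false, if_true, mul_one]
      rw [Finset.prod_inv_distrib]
      congr 1
      rw [← Finset.prod_range_add_one_eq_factorial n]
      push_cast
      rfl
    have hN1 : N.eval (v 0) = ((n : ℝ) + 1) * ((n + 1).factorial : ℝ) := by
      rw [hNeval]
      have h2 : ∏ j ∈ Finset.range n, (v 0 - ((j : ℝ) + 1)) = (-1 : ℝ) ^ n * ((n + 1).factorial : ℝ) := by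
        have h3 : ∀ j ∈ Finset.range n, (v 0 - ((j : ℝ) + 1)) = (-1 : ℝ) * ((j + 1 : ℕ) + 1 : ℝ) := by
          intro j _
          simp only [hv]
          push_cast
          ring
        rw [Finset.prod_congr rfl h3, Finset.prod_mul_distrib, Finset.prod_const, Finset.card_range]
        congr 1
        have h4 := Finset.prod_range_succ' (fun i : ℕ ↦ ((i : ℝ) + 1)) n
        rw [show ∏ i ∈ Finset.range (n + 1), ((i : ℝ) + 1) = ((n + 1).factorial : ℝ) by
          rw [← Finset.prod_range_add_one_eq_factorial (n + 1)]; push_cast; rfl] at h4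
        rw [h4]
        push_cast
        ring
      rw [h2]
      have h5 : ((-1 : ℝ) ^ n) * (-1 : ℝ) ^ n = 1 := by
        rw [← mul_pow]; norm_num
      linear_combination ((n : ℝ) + 1) * ((n + 1).factorial : ℝ) * h5
    show Lagrange.nodalWeight s v 0 * N.eval (v 0) = ((n : ℝ) + 1) ^ 2
    rw [hw, hN1, Nat.factorial_succ]
    push_cast
    have hf : (n.factorial : ℝ) ≠ 0 := by positivity
    field_simp
  · intro k hk
    have hx : ∀ i ∈ s, (k : ℝ) ≠ v i := by
      intro i _
      simp only [hv]
      have : (0 : ℝ) ≤ k := Nat.cast_nonneg k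
      have : (0 : ℝ) ≤ i := Nat.cast_nonneg i
      intro h
      linarith
    have key := Lagrange.eval_interpolate_not_at_node (fun i ↦ N.eval (v i)) hx
    rw [← hinterp] at key
    have hnodal : (Lagrange.nodal s v).eval (k : ℝ) = ∏ i ∈ s, ((k : ℝ) + i + 1) := by
      rw [Lagrange.eval_nodal]
      refine Finset.prod_congr rfl fun i _ ↦ ?_
      simp only [hv]
      ring
    have hnodal_pos : 0 < (Lagrange.nodal s v).eval (k : ℝ) := by
      rw [hnodal]
      exact Finset.prod_pos fun i _ ↦ by positivity
    have hsum : ∑ l ∈ s, Lagrange.nodalWeight s v l * N.eval (v l) / ((k : ℝ) + l + 1) =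
        ∑ i ∈ s, Lagrange.nodalWeight s v i * ((k : ℝ) - v i)⁻¹ * N.eval (v i) := by
      refine Finset.sum_congr rfl fun i _ ↦ ?_
      simp only [hv, sub_neg_eq_add]
      rw [div_eq_mul_inv, ← add_assoc]
      ring
    rw [hsum, ← mul_right_inj' hnodal_pos.ne', ← key, hNeval]
    split_ifs with hk0
    · -- `k = 0`: both sides are `(n+1)!`
      subst hk0
      rw [mul_one, hnodal]
      have h3 : ∀ j ∈ Finset.range n, (((0 : ℕ) : ℝ) - ((j : ℝ) + 1)) = (-1 : ℝ) * ((j : ℝ) + 1) := by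
        intro j _; push_cast; ring
      rw [Finset.prod_congr rfl h3, Finset.prod_mul_distrib, Finset.prod_const, Finset.card_range]
      have h5 : ((-1 : ℝ) ^ n) * (-1 : ℝ) ^ n = 1 := by rw [← mul_pow]; norm_num
      have h6 : ∏ i ∈ s, (((0 : ℕ) : ℝ) + i + 1) = ((n + 1).factorial : ℝ) := by
        rw [hs, ← Finset.prod_range_add_one_eq_factorial (n + 1)]
        push_cast
        exact Finset.prod_congr rfl fun i _ ↦ by ring
      have h7 : ∏ i ∈ Finset.range n, ((i : ℝ) + 1) = (n.factorial : ℝ) := by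
        rw [← Finset.prod_range_add_one_eq_factorial n]
        push_cast
        rfl
      rw [h6, h7, Nat.factorial_succ]
      push_cast
      linear_combination (((n : ℝ) + 1) * (n.factorial : ℝ)) * h5
    · -- `1 ≤ k ≤ n`: the factor `j = k - 1` vanishes
      rw [mul_zero]
      have hmem : k - 1 ∈ Finset.range n := by
        rw [Finset.mem_range]; omega
      rw [Finset.prod_eq_zero hmem, mul_zero]
      have : ((k - 1 : ℕ) : ℝ) = (k : ℝ) - 1 := by
        rw [Nat.cast_sub (by omega)]; simp
      rw [this]; ring

/-! ## 2. `L²((0,∞))` bookkeeping -/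

/-- `conj` preserves `L²`. [folklore] -/
theorem memLp_conj {y : ℝ → ℂ} (hy : MemLp y 2 (volume.restrict (Set.Ioi (0 : ℝ)))) : MemLp (fun t ↦ conj (y t)) 2 (volume.restrict (Set.Ioi (0 : ℝ))) := by
  have hm : AEStronglyMeasurable (fun t ↦ conj (y t)) (volume.restrict (Set.Ioi (0 : ℝ))) :=
    continuous_conj.comp_aestronglyMeasurable hy.1
  refine (memLp_two_iff_integrable_sq_norm hm).2 ?_
  exact ((memLp_two_iff_integrable_sq_norm hy.1).1 hy).congr
    (Eventually.of_forall fun t ↦ by simp)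

/-- The product of two `L²` functions is integrable (Cauchy–Schwarz). [folklore] -/
theorem integrable_mul_conj {f y : ℝ → ℂ} (hf : MemLp f 2 (volume.restrict (Set.Ioi (0 : ℝ)))) (hy : MemLp y 2 (volume.restrict (Set.Ioi (0 : ℝ)))) :
    Integrable (fun t ↦ f t * conj (y t)) (volume.restrict (Set.Ioi (0 : ℝ))) :=
  hf.integrable_mul (memLp_conj hy)

/-- `χ = 𝟙_{(0,1]} ∈ L²((0,∞))` (as a complex function). [folklore] -/
theorem memLp_nbChi : MemLp (fun t : ℝ ↦ ((nbChi t : ℝ) : ℂ)) 2 (volume.restrict (Set.Ioi (0 : ℝ))) := by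
  have h : MemLp ((Set.Ioc (0 : ℝ) 1).indicator fun _ ↦ (1 : ℝ)) 2 (volume.restrict (Set.Ioi (0 : ℝ))) :=
    memLp_indicator_const 2 measurableSet_Ioc 1 (Or.inr (by
      rw [Measure.restrict_apply measurableSet_Ioc]
      exact ((measure_mono Set.inter_subset_left).trans_lt measure_Ioc_lt_top).ne))
  exact h.ofReal

/-- The Beurling functions `{1/(at)}`, `a ≥ 1`, lie in `L²((0,∞))` (as complex functions).
[folklore] -/
theorem memLp_beurlingRho {a : ℝ} (ha : 1 ≤ a) : MemLp (fun t : ℝ ↦ ((beurlingRho a t : ℝ) : ℂ)) 2 (volume.restrict (Set.Ioi (0 : ℝ))) :=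
  (memLp_two_fract_one_div ha).ofReal

/-- `(f, ∑_σ A_σ X_σ) = ∑_σ conj(A_σ) (f, X_σ)` for `L²` data. [folklore] -/
theorem integral_mul_conj_sum {ι : Type*} (S : Finset ι) (A : ι → ℂ) {f : ℝ → ℂ} {Xf : ι → ℝ → ℂ}
    (hf : MemLp f 2 (volume.restrict (Set.Ioi (0 : ℝ)))) (hX : ∀ σ ∈ S, MemLp (Xf σ) 2 (volume.restrict (Set.Ioi (0 : ℝ)))) :
    ∫ t in Set.Ioi (0 : ℝ), f t * conj (∑ σ ∈ S, A σ * Xf σ t) =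
      ∑ σ ∈ S, conj (A σ) * ∫ t in Set.Ioi (0 : ℝ), f t * conj (Xf σ t) := by
  have e : ∀ t, f t * conj (∑ σ ∈ S, A σ * Xf σ t) = ∑ σ ∈ S, conj (A σ) * (f t * conj (Xf σ t)) := by
    intro t
    rw [map_sum, Finset.mul_sum]
    exact Finset.sum_congr rfl fun σ _ ↦ by rw [map_mul]; ring
  simp_rw [e]
  rw [integral_finsetSum _ fun σ hσ ↦ ((integrable_mul_conj hf (hX σ hσ)).const_mul (conj (A σ)))]
  exact Finset.sum_congr rfl fun σ _ ↦ integral_const_mul _ _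

/-- `(∑_σ A_σ X_σ, g) = ∑_σ A_σ (X_σ, g)` for `L²` data. [folklore] -/
theorem integral_sum_mul_conj {ι : Type*} (S : Finset ι) (A : ι → ℂ) {g : ℝ → ℂ} {Xf : ι → ℝ → ℂ}
    (hg : MemLp g 2 (volume.restrict (Set.Ioi (0 : ℝ)))) (hX : ∀ σ ∈ S, MemLp (Xf σ) 2 (volume.restrict (Set.Ioi (0 : ℝ)))) :
    ∫ t in Set.Ioi (0 : ℝ), (∑ σ ∈ S, A σ * Xf σ t) * conj (g t) =
      ∑ σ ∈ S, A σ * ∫ t in Set.Ioi (0 : ℝ), Xf σ t * conj (g t) := by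
  have e : ∀ t, (∑ σ ∈ S, A σ * Xf σ t) * conj (g t) = ∑ σ ∈ S, A σ * (Xf σ t * conj (g t)) := by
    intro t
    rw [Finset.sum_mul]
    exact Finset.sum_congr rfl fun σ _ ↦ by ring
  simp_rw [e]
  rw [integral_finsetSum _ fun σ hσ ↦ ((integrable_mul_conj (hX σ hσ) hg).const_mul (A σ))]
  exact Finset.sum_congr rfl fun σ _ ↦ integral_const_mul _ _

/-- `∫ y ȳ = ∫ ‖y‖²` (as a complex number). [folklore] -/
theorem integral_mul_conj_self (y : ℝ → ℂ) :
    ∫ t in Set.Ioi (0 : ℝ), y t * conj (y t) = ((∫ t in Set.Ioi (0 : ℝ), ‖y t‖ ^ 2 : ℝ) : ℂ) := by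
  rw [← integral_complex_ofReal]
  refine integral_congr_ae (Eventually.of_forall fun t ↦ ?_)
  show y t * conj (y t) = ((‖y t‖ ^ 2 : ℝ) : ℂ)
  rw [mul_conj']
  push_cast
  rfl

/-! ## 3. Duality: `D(λ) ≥ |(χ, y)| / ‖y‖` for every `y ⊥ 𝓑_λ` -/

/-- **Duality bound.** If `y ∈ L²((0,∞))` is orthogonal to every `t ↦ {1/(at)}`, `1 ≤ a ≤ 1/λ`,
then every Beurling combination `f = ∑ⱼ cⱼ {1/(aⱼ t)}` with `1 ≤ aⱼ ≤ 1/λ` satisfies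
`‖χ - f‖_{L²(0,∞)} ≥ |(χ, y)|/‖y‖` (`(χ - f, y) = (χ, y)` and Cauchy–Schwarz): "`D(λ)` is bounded
below by the norm of the orthogonal projection of `χ₁` to … `H_R`". [cite: Burnol2002, Thm. 5.4 (proof)] -/
theorem genError_ge_of_orthogonal {lam : ℝ} {y : ℝ → ℂ} (hy : MemLp y 2 (volume.restrict (Set.Ioi (0 : ℝ))))
    (horth : ∀ a : ℝ, 1 ≤ a → a ≤ 1 / lam →
      ∫ t in Set.Ioi (0 : ℝ), ((beurlingRho a t : ℝ) : ℂ) * conj (y t) = 0)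
    {n : ℕ} (a c : Fin n → ℝ) (ha : ∀ j, 1 ≤ a j ∧ a j ≤ 1 / lam) :
    ENNReal.ofReal (‖∫ t in Set.Ioi (0 : ℝ), ((nbChi t : ℝ) : ℂ) * conj (y t)‖ /
        Real.sqrt (∫ t in Set.Ioi (0 : ℝ), ‖y t‖ ^ 2)) ≤ genError a c := by
  set N : ℝ := ∫ t in Set.Ioi (0 : ℝ), ‖y t‖ ^ 2 with hNdef
  have hN0 : 0 ≤ N := integral_nonneg fun t ↦ by positivity
  have hyn : (eLpNorm y 2 (volume.restrict (Set.Ioi (0 : ℝ)))).toReal = Real.sqrt N := by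
    rw [hy.eLpNorm_eq_integral_rpow_norm two_ne_zero ENNReal.ofNat_ne_top, ENNReal.toReal_ofReal
      (by positivity), Real.sqrt_eq_rpow]
    norm_num
    rfl
  -- if the error is infinite there is nothing to prove
  by_cases htop : genError a c = ⊤
  · rw [htop]; exact le_top
  set ε : ℝ := (genError a c).toReal with hε
  have hEε : genError a c = ENNReal.ofReal ε := (ENNReal.ofReal_toReal htop).symm
  have hε0 : 0 ≤ ε := ENNReal.toReal_nonneg
  -- the complex error function `g = χ - ∑ cⱼ {1/(aⱼ t)}`
  set g : ℝ → ℂ := nbFun a c with hg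
  have hgL2 : MemLp g 2 (volume.restrict (Set.Ioi (0 : ℝ))) := memLp_two_nbFun a c fun j ↦ (ha j).1
  have hg2 : eLpNorm g 2 (volume.restrict (Set.Ioi (0 : ℝ))) = ENNReal.ofReal ε := by
    rw [← hEε]
    unfold genError l2Ioi
    refine eLpNorm_congr_norm_ae (Eventually.of_forall fun x ↦ ?_)
    simp only [hg, nbFun, nbChi, beurlingRho, Complex.norm_real]
  -- the pairing `(g, y) = (χ, y)`
  set P : ℂ := ∫ t in Set.Ioi (0 : ℝ), ((nbChi t : ℝ) : ℂ) * conj (y t) with hPdef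
  have hP : ∫ t in Set.Ioi (0 : ℝ), g t * conj (y t) = P := by
    have e : ∀ t, g t * conj (y t) = ((nbChi t : ℝ) : ℂ) * conj (y t) -
        ∑ j, (c j : ℂ) * (((beurlingRho (a j) t : ℝ) : ℂ) * conj (y t)) := by
      intro t
      simp only [hg, nbFun, nbChi, beurlingRho]
      push_cast
      rw [sub_mul, Finset.sum_mul]
      congr 1
      exact Finset.sum_congr rfl fun j _ ↦ by ring
    simp_rw [e]
    have hint : ∀ j ∈ (Finset.univ : Finset (Fin n)), Integrable (fun t ↦ (c j : ℂ) *
        (((beurlingRho (a j) t : ℝ) : ℂ) * conj (y t))) (volume.restrict (Set.Ioi (0 : ℝ))) :=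
      fun j _ ↦ (integrable_mul_conj (memLp_beurlingRho (ha j).1) hy).const_mul _
    rw [integral_sub (integrable_mul_conj memLp_nbChi hy) (integrable_finsetSum _ hint),
      integral_finsetSum _ hint]
    have h0 : ∀ j : Fin n, ∫ t in Set.Ioi (0 : ℝ), (c j : ℂ) *
        (((beurlingRho (a j) t : ℝ) : ℂ) * conj (y t)) = 0 := by
      intro j
      rw [integral_const_mul, horth (a j) (ha j).1 (ha j).2, mul_zero]
    simp_rw [h0]
    rw [Finset.sum_const_zero, sub_zero]
  -- Cauchy–Schwarz on `(0,∞)`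
  have hCS : ‖∫ t in Set.Ioi (0 : ℝ), g t * conj (y t)‖ ≤ ε * Real.sqrt N := by
    set cv : ℝ → ℂ := fun t ↦ conj (y t) with hcv
    have hcvm : AEStronglyMeasurable cv (volume.restrict (Set.Ioi (0 : ℝ))) := continuous_conj.comp_aestronglyMeasurable hy.1
    have hcvn : eLpNorm cv 2 (volume.restrict (Set.Ioi (0 : ℝ))) = eLpNorm y 2 (volume.restrict (Set.Ioi (0 : ℝ))) :=
      eLpNorm_congr_norm_ae (Eventually.of_forall fun t ↦ by simp [hcv])
    have hprod : (fun t : ℝ ↦ g t * conj (y t)) = g • cv := by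
      funext t; simp [hcv]
    have hH : eLpNorm (g • cv) 1 (volume.restrict (Set.Ioi (0 : ℝ))) ≤ ENNReal.ofReal ε * eLpNorm y 2 (volume.restrict (Set.Ioi (0 : ℝ))) := by
      have := eLpNorm_smul_le_mul_eLpNorm hcvm hgL2.1 (p := 2) (q := 2) (r := 1)
      rw [hg2, hcvn] at this
      exact this
    have hfin : ENNReal.ofReal ε * eLpNorm y 2 (volume.restrict (Set.Ioi (0 : ℝ))) ≠ ⊤ :=
      ENNReal.mul_ne_top ENNReal.ofReal_ne_top hy.eLpNorm_lt_top.ne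
    calc ‖∫ t in Set.Ioi (0 : ℝ), g t * conj (y t)‖
        ≤ (∫⁻ t in Set.Ioi (0 : ℝ), ENNReal.ofReal ‖g t * conj (y t)‖).toReal :=
          norm_integral_le_lintegral_norm _
      _ = (eLpNorm (g • cv) 1 (volume.restrict (Set.Ioi (0 : ℝ)))).toReal := by
          rw [← hprod, eLpNorm_one_eq_lintegral_enorm]
          simp_rw [ofReal_norm]
      _ ≤ (ENNReal.ofReal ε * eLpNorm y 2 (volume.restrict (Set.Ioi (0 : ℝ)))).toReal := ENNReal.toReal_mono hfin hH
      _ = ε * Real.sqrt N := by rw [ENNReal.toReal_mul, ENNReal.toReal_ofReal hε0, hyn]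
  rw [hP] at hCS
  -- conclude
  rw [hEε, ENNReal.ofReal_le_ofReal_iff hε0]
  rcases eq_or_lt_of_le (Real.sqrt_nonneg N) with h | h
  · rw [← h, div_zero]; exact hε0
  · rw [div_le_iff₀ h]; exact hCS

end Burnol2002Assembly

/-! ## 4. Construction of Burnol's vectors on the Mellin side -/

namespace Burnol2002Construction

open Literature.NumberTheory.LFunctions Literature.NumberTheory.LFunctions.BurnolVectors

variable (γ : ℝ) (k : ℕ)

/-- `im(1/2 + iγ) = γ`. [folklore] -/
lemma im_line : ((1 / 2 : ℂ) + γ * I).im = γ := by simp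

/-- The line datum is in `L¹ ∩ L²` (`0 < λ < 1`). [folklore] -/
theorem integrable_lineDatum {lam : ℝ} (h0 : 0 < lam) (h1 : lam < 1) :
    Integrable (fun τ : ℝ ↦ burnolLineDatum γ k lam ((1 / 2 : ℂ) + τ * I)) ∧
      MemLp (fun τ : ℝ ↦ burnolLineDatum γ k lam ((1 / 2 : ℂ) + τ * I)) 2 := by
  obtain ⟨hI, hM⟩ := integrable_burnolKk_line h0 h1 γ k
  have hm : AEStronglyMeasurable (fun τ : ℝ ↦ burnolLineDatum γ k lam ((1 / 2 : ℂ) + τ * I)) volume :=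
    continuous_conj.comp_aestronglyMeasurable hI.1
  refine ⟨hI.norm.mono' hm (Eventually.of_forall fun τ ↦ by simp [burnolLineDatum]), ?_⟩
  refine (memLp_two_iff_integrable_sq_norm hm).2 ?_
  exact ((memLp_two_iff_integrable_sq_norm hI.1).1 hM).congr
    (Eventually.of_forall fun τ ↦ by simp [burnolLineDatum])

/-- `v ∈ L²(0,∞)` with `‖v‖² = (1/2π) ∫ ‖K_k‖²`. [folklore] -/
theorem memLp_vec {lam : ℝ} (h0 : 0 < lam) (h1 : lam < 1) :
    MemLp (burnolVec γ k lam) 2 (volume.restrict (Ioi 0)) := by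
  obtain ⟨hI, hM⟩ := integrable_lineDatum γ k h0 h1
  exact (integral_norm_sq_mellinInv hI hM).1

/-- **Pairing of a Mellin-convergent function with `v`**:
`∫_0^∞ g · conj(v) = (1/2π) ∫ 𝓜g(s) K_k(s) dτ`. [folklore] -/
theorem integral_mul_conj_vec {lam : ℝ} (h0 : 0 < lam) (h1 : lam < 1) {g : ℝ → ℂ}
    (hg : MellinConvergent g (1 / 2)) :
    ∫ t in Ioi (0 : ℝ), g t * conj (burnolVec γ k lam t) =
      (1 / (2 * π) : ℂ) * ∫ τ : ℝ, mellin g ((1 / 2 : ℂ) + τ * I) *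
        burnolKk ((1 / 2 : ℂ) + γ * I) k lam ((1 / 2 : ℂ) + τ * I) := by
  obtain ⟨hI, -⟩ := integrable_lineDatum γ k h0 h1
  rw [burnolVec, integral_mul_conj_mellinInv hg hI]
  congr 1
  exact integral_congr_ae (Eventually.of_forall fun τ ↦ by simp [burnolLineDatum])

/-- **Orthogonality**: `∫_0^∞ {1/(at)} · conj(v(t)) dt = 0` for `1 ≤ a ≤ 1/λ` when `k < m(ρ)`.
[cite: Burnol2002, Cor. 4.3] -/
theorem integral_fract_mul_conj_vec_eq_zero {lam : ℝ} (h0 : 0 < lam) (h1 : lam < 1)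
    (hk : (k : ℤ) < riemannZetaZeroOrder ((1 / 2 : ℂ) + γ * I)) {a : ℝ} (ha : 1 ≤ a) (ha' : a ≤ 1 / lam) :
    ∫ t in Ioi (0 : ℝ), ((Int.fract (1 / (a * t)) : ℝ) : ℂ) * conj (burnolVec γ k lam t) = 0 := by
  have hfr : ∀ w : ℂ, 0 < w.re → w.re < 1 → HasMellin (fun t : ℝ ↦ ((Int.fract (1 / (a * t)) : ℝ) : ℂ)) w
      ((a : ℂ) ^ (-w) * (-riemannZeta w / w)) :=
    fun w hw0 hw1 ↦ BaezDuarteOnlyIf.hasMellin_fract_one_div_mul (by linarith) hw0 hw1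
  have hconv : MellinConvergent (fun t : ℝ ↦ ((Int.fract (1 / (a * t)) : ℝ) : ℂ)) (1 / 2) :=
    (hfr (1 / 2) (by norm_num) (by norm_num)).1
  rw [integral_mul_conj_vec γ k h0 h1 hconv]
  have e : ∀ τ : ℝ, mellin (fun t : ℝ ↦ ((Int.fract (1 / (a * t)) : ℝ) : ℂ)) ((1 / 2 : ℂ) + τ * I) =
      (a : ℂ) ^ (-((1 / 2 : ℂ) + τ * I)) *
        (-riemannZeta ((1 / 2 : ℂ) + τ * I) / ((1 / 2 : ℂ) + τ * I)) :=
    fun τ ↦ (hfr _ (by simp) (by simp; norm_num)).2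
  simp_rw [e]
  rw [integral_mellin_fract_mul_burnolKk_eq_zero hk h0 h1 ha ha', mul_zero]

/-- **Pairing with `χ`**: `∫_0^∞ χ · conj(v) = (1/2π) ∫ K_k(s)/s dτ` (`𝓜χ = 1/s`). [folklore] -/
theorem integral_chi_mul_conj_vec {lam : ℝ} (h0 : 0 < lam) (h1 : lam < 1) :
    ∫ t in Ioi (0 : ℝ), (Ioc (0 : ℝ) 1).indicator (fun _ ↦ (1 : ℂ)) t * conj (burnolVec γ k lam t) =
      (1 / (2 * π) : ℂ) * ∫ τ : ℝ, burnolKk ((1 / 2 : ℂ) + γ * I) k lam ((1 / 2 : ℂ) + τ * I) /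
        ((1 / 2 : ℂ) + τ * I) := by
  have hconv : MellinConvergent ((Ioc (0 : ℝ) 1).indicator (fun _ ↦ (1 : ℂ))) (1 / 2) :=
    (hasMellin_one_Ioc (s := 1 / 2) (by norm_num)).1
  rw [integral_mul_conj_vec γ k h0 h1 hconv]
  congr 1
  refine integral_congr_ae (Eventually.of_forall fun τ ↦ ?_)
  beta_reduce
  rw [(hasMellin_one_Ioc (s := (1 / 2 : ℂ) + τ * I) (by simp)).2]
  ring

/-- **Gram entries**: `∫_0^∞ v_{γ,k} conj(v_{γ',l}) = (1/2π) ∫ conj(K_{γ,k}) K_{γ',l} dτ`. [folklore] -/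
theorem integral_vec_mul_conj_vec {lam : ℝ} (h0 : 0 < lam) (h1 : lam < 1) (γ' : ℝ) (l : ℕ) :
    ∫ t in Ioi (0 : ℝ), burnolVec γ k lam t * conj (burnolVec γ' l lam t) =
      (1 / (2 * π) : ℂ) * ∫ τ : ℝ, conj (burnolKk ((1 / 2 : ℂ) + γ * I) k lam ((1 / 2 : ℂ) + τ * I)) *
        burnolKk ((1 / 2 : ℂ) + γ' * I) l lam ((1 / 2 : ℂ) + τ * I) := by
  obtain ⟨hI, hM⟩ := integrable_lineDatum γ k h0 h1
  obtain ⟨hI', hM'⟩ := integrable_lineDatum γ' l h0 h1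
  rw [burnolVec, burnolVec, integral_mellinInv_mul_conj_mellinInv hI hM hI' hM']
  congr 1
  exact integral_congr_ae (Eventually.of_forall fun τ ↦ by simp [burnolLineDatum])

/-! ### The normalising constants -/

/-- `conj(ε_ρ) ε_ρ = 1` (`ρ ≠ 0`). [folklore] -/
lemma conj_phase_mul_phase {ρ : ℂ} (hρ : ρ ≠ 0) : conj (burnolPhase ρ) * burnolPhase ρ = 1 := by
  have hn : (‖ρ‖ : ℂ) ≠ 0 := by exact_mod_cast norm_ne_zero_iff.2 hρ
  have key : ρ * conj ρ = ((‖ρ‖ : ℂ)) ^ 2 := Complex.mul_conj' ρ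
  rw [burnolPhase, map_div₀, map_neg, map_pow, Complex.conj_conj, Complex.conj_ofReal, div_mul_div_comm,
    neg_mul_neg, ← mul_pow, key]
  push_cast
  field_simp

/-- `coef_k conj(coef_l) = (-1)^{k+l}/(w L^{k+l+1})` at the same zero (`0 < λ < 1`). [folklore] -/
theorem coef_mul_conj_coef {lam : ℝ} (h0 : 0 < lam) (h1 : lam < 1) (l : ℕ) :
    burnolCoef ((1 / 2 : ℂ) + γ * I) k lam * conj (burnolCoef ((1 / 2 : ℂ) + γ * I) l lam) =
      (-1) ^ (k + l) / ((wR γ : ℂ) * (Lof lam : ℂ) ^ (k + l + 1)) := by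
  have hL := Lof_pos h0 h1
  have hw := wR_pos' γ
  have hph := conj_phase_mul_phase (line_ne_zero γ)
  have e1 : (Real.sqrt (wR γ) : ℂ) * Real.sqrt (wR γ) = (wR γ : ℂ) := by
    rw [← ofReal_mul, Real.mul_self_sqrt hw.le]
  have e2 : (Real.sqrt (Lof lam) : ℂ) * Real.sqrt (Lof lam) = (Lof lam : ℂ) := by
    rw [← ofReal_mul, Real.mul_self_sqrt hL.le]
  simp only [burnolCoef, im_line, map_div₀, map_mul, map_pow, map_neg, map_one, Complex.conj_ofReal]
  rw [div_mul_div_comm]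
  have num : burnolPhase ((1 / 2 : ℂ) + γ * I) * (-1) ^ k * (conj (burnolPhase ((1 / 2 : ℂ) + γ * I)) * (-1) ^ l) =
      (-1) ^ (k + l) := by
    rw [pow_add]
    linear_combination ((-1 : ℂ) ^ k * (-1) ^ l) * hph
  have den : ((Real.sqrt (wR γ) : ℂ) * (Lof lam : ℂ) ^ k * Real.sqrt (Lof lam)) *
      ((Real.sqrt (wR γ) : ℂ) * (Lof lam : ℂ) ^ l * Real.sqrt (Lof lam)) =
      (wR γ : ℂ) * (Lof lam : ℂ) ^ (k + l + 1) := by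
    rw [pow_add, pow_succ]
    linear_combination ((Lof lam : ℂ) ^ k * (Lof lam : ℂ) ^ l * ((Real.sqrt (Lof lam) : ℂ) *
      Real.sqrt (Lof lam))) * e1 + ((wR γ : ℂ) * (Lof lam : ℂ) ^ k * (Lof lam : ℂ) ^ l) * e2
  rw [num, den]

/-- The cross coefficient is a `λ`-independent constant times `L^{-(k+l+1)}` (`0 < λ < 1`). [folklore] -/
theorem coef_mul_conj_coef_cross {lam : ℝ} (h0 : 0 < lam) (h1 : lam < 1) (γ' : ℝ) (l : ℕ) :
    burnolCoef ((1 / 2 : ℂ) + γ * I) k lam * conj (burnolCoef ((1 / 2 : ℂ) + γ' * I) l lam) =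
      (burnolPhase ((1 / 2 : ℂ) + γ * I) * conj (burnolPhase ((1 / 2 : ℂ) + γ' * I)) * (-1) ^ (k + l) /
        ((Real.sqrt (wR γ) : ℂ) * Real.sqrt (wR γ'))) * ((Lof lam : ℂ) ^ (k + l + 1))⁻¹ := by
  have hL := Lof_pos h0 h1
  have hsw : (Real.sqrt (wR γ) : ℂ) ≠ 0 := by exact_mod_cast (Real.sqrt_pos.2 (wR_pos' γ)).ne'
  have hsw' : (Real.sqrt (wR γ') : ℂ) ≠ 0 := by exact_mod_cast (Real.sqrt_pos.2 (wR_pos' γ')).ne'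
  have hsL : (Real.sqrt (Lof lam) : ℂ) ≠ 0 := by exact_mod_cast (Real.sqrt_pos.2 hL).ne'
  have hL0 : (Lof lam : ℂ) ≠ 0 := by exact_mod_cast hL.ne'
  have e2 : (Real.sqrt (Lof lam) : ℂ) * Real.sqrt (Lof lam) = (Lof lam : ℂ) := by
    rw [← ofReal_mul, Real.mul_self_sqrt hL.le]
  simp only [burnolCoef, im_line, map_div₀, map_mul, map_pow, map_neg, map_one, Complex.conj_ofReal]
  rw [div_mul_div_comm]
  have num : burnolPhase ((1 / 2 : ℂ) + γ * I) * (-1) ^ k * (conj (burnolPhase ((1 / 2 : ℂ) + γ' * I)) * (-1) ^ l) =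
      burnolPhase ((1 / 2 : ℂ) + γ * I) * conj (burnolPhase ((1 / 2 : ℂ) + γ' * I)) * (-1) ^ (k + l) := by
    rw [pow_add]; ring
  have den : ((Real.sqrt (wR γ) : ℂ) * (Lof lam : ℂ) ^ k * Real.sqrt (Lof lam)) *
      ((Real.sqrt (wR γ') : ℂ) * (Lof lam : ℂ) ^ l * Real.sqrt (Lof lam)) =
      ((Real.sqrt (wR γ) : ℂ) * Real.sqrt (wR γ')) * (Lof lam : ℂ) ^ (k + l + 1) := by
    rw [pow_add, pow_succ]
    linear_combination ((Real.sqrt (wR γ) : ℂ) * Real.sqrt (wR γ') * (Lof lam : ℂ) ^ k *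
      (Lof lam : ℂ) ^ l) * e2
  rw [num, den, ← div_div, div_eq_mul_inv]

/-- `√(log(1/λ)) · conj(coef_k) = (conj(ε)(-1)^k/√w) · L^{-k}` (`0 < λ < 1`). [folklore] -/
theorem sqrt_mul_conj_coef {lam : ℝ} (h0 : 0 < lam) (h1 : lam < 1) :
    (Real.sqrt (Real.log (1 / lam)) : ℂ) * conj (burnolCoef ((1 / 2 : ℂ) + γ * I) k lam) =
      (conj (burnolPhase ((1 / 2 : ℂ) + γ * I)) * (-1) ^ k / (Real.sqrt (wR γ) : ℂ)) * ((Lof lam : ℂ) ^ k)⁻¹ := by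
  have hL := Lof_pos h0 h1
  have hlog : Real.log (1 / lam) = Lof lam := by rw [one_div, Real.log_inv]; rfl
  have hsw : (Real.sqrt (wR γ) : ℂ) ≠ 0 := by exact_mod_cast (Real.sqrt_pos.2 (wR_pos' γ)).ne'
  have hsL : (Real.sqrt (Lof lam) : ℂ) ≠ 0 := by exact_mod_cast (Real.sqrt_pos.2 hL).ne'
  have hL0 : (Lof lam : ℂ) ≠ 0 := by exact_mod_cast hL.ne'
  rw [hlog]
  simp only [burnolCoef, im_line, map_div₀, map_mul, map_pow, map_neg, map_one, Complex.conj_ofReal]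
  field_simp

/-- **The `k = 0` limit value**: `(conj(ε_ρ)/√w(γ)) · (1/2π) · (-2π (ρ-1)/ρ⁵) = (ρ-1)/ρ²`
(`√w = ‖ρ‖⁻³`, `conj(ε_ρ) = -ρ³/‖ρ‖³`). [folklore] -/
theorem phase_limit_value :
    conj (burnolPhase ((1 / 2 : ℂ) + γ * I)) * (-1) ^ 0 / (Real.sqrt (wR γ) : ℂ) *
        ((1 / (2 * π) : ℂ) * -(2 * π * ((((1 / 2 : ℂ) + γ * I) - 1) / ((1 / 2 : ℂ) + γ * I) ^ 5))) =
      (((1 / 2 : ℂ) + γ * I) - 1) / ((1 / 2 : ℂ) + γ * I) ^ 2 := by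
  set ρ : ℂ := (1 / 2 : ℂ) + γ * I with hρ
  have hρ0 : ρ ≠ 0 := line_ne_zero γ
  have hn0 : ‖ρ‖ ≠ 0 := norm_ne_zero_iff.2 hρ0
  have hn : (‖ρ‖ : ℂ) ≠ 0 := by exact_mod_cast hn0
  have hπ : (π : ℂ) ≠ 0 := by exact_mod_cast Real.pi_ne_zero
  have hsqrt : Real.sqrt (wR γ) = (‖ρ‖ ^ 3)⁻¹ := by
    rw [wR_eq, ← hρ, Real.sqrt_inv, show ‖ρ‖ ^ 6 = (‖ρ‖ ^ 3) ^ 2 by ring, Real.sqrt_sq (by positivity)]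
  rw [hsqrt, burnolPhase, map_div₀, map_neg, map_pow, Complex.conj_conj, Complex.conj_ofReal]
  push_cast
  field_simp

/-! ### The six properties of the vectors -/

variable {γ k}

/-- (1) `X ∈ L²(0,∞)`. [cite: Burnol2002, Definition 5.1] -/
theorem memLp_burnolX {lam : ℝ} (h0 : 0 < lam) (h1 : lam < 1) (γ : ℝ) (k : ℕ) :
    MemLp (burnolX lam ((1 / 2 : ℂ) + γ * I) k) 2 (volume.restrict (Ioi 0)) := by
  have e : burnolX lam ((1 / 2 : ℂ) + γ * I) k = fun t ↦ burnolCoef ((1 / 2 : ℂ) + γ * I) k lam * burnolVec γ k lam t := by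
    funext t; simp [burnolX]
  rw [e]
  exact (memLp_vec γ k h0 h1).const_mul _

/-- (2) `X ⊥ {1/(at)}` for `1 ≤ a ≤ 1/λ` (`k < m(ρ)`). [cite: Burnol2002, Cor. 4.3] -/
theorem integral_beurlingRho_mul_conj_burnolX {lam : ℝ} (h0 : 0 < lam) (h1 : lam < 1) {γ : ℝ} {k : ℕ}
    (hk : (k : ℤ) < riemannZetaZeroOrder ((1 / 2 : ℂ) + γ * I)) {a : ℝ} (ha : 1 ≤ a) (ha' : a ≤ 1 / lam) :
    ∫ t in Ioi (0 : ℝ), ((beurlingRho a t : ℝ) : ℂ) * conj (burnolX lam ((1 / 2 : ℂ) + γ * I) k t) = 0 := by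
  have e : ∀ t : ℝ, ((beurlingRho a t : ℝ) : ℂ) * conj (burnolX lam ((1 / 2 : ℂ) + γ * I) k t) =
      conj (burnolCoef ((1 / 2 : ℂ) + γ * I) k lam) *
        (((Int.fract (1 / (a * t)) : ℝ) : ℂ) * conj (burnolVec γ k lam t)) := by
    intro t
    simp only [burnolX, im_line, beurlingRho, map_mul]
    ring
  simp_rw [e]
  rw [integral_const_mul, integral_fract_mul_conj_vec_eq_zero γ k h0 h1 hk ha ha', mul_zero]

/-- (3)/(4) The Gram entries in terms of the Mellin-side Gram integrals. [folklore] -/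
theorem integral_burnolX_mul_conj_burnolX {lam : ℝ} (h0 : 0 < lam) (h1 : lam < 1) (γ γ' : ℝ) (k l : ℕ) :
    ∫ t in Ioi (0 : ℝ), burnolX lam ((1 / 2 : ℂ) + γ * I) k t * conj (burnolX lam ((1 / 2 : ℂ) + γ' * I) l t) =
      burnolCoef ((1 / 2 : ℂ) + γ * I) k lam * conj (burnolCoef ((1 / 2 : ℂ) + γ' * I) l lam) *
        ((1 / (2 * π) : ℂ) * ∫ τ : ℝ, conj (burnolKk ((1 / 2 : ℂ) + γ * I) k lam ((1 / 2 : ℂ) + τ * I)) *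
          burnolKk ((1 / 2 : ℂ) + γ' * I) l lam ((1 / 2 : ℂ) + τ * I)) := by
  rw [← integral_vec_mul_conj_vec γ k h0 h1 γ' l, ← integral_const_mul]
  refine integral_congr_ae (Eventually.of_forall fun t ↦ ?_)
  simp only [burnolX, im_line, map_mul]
  ring

/-- (3) **Same zero**: `∫ X_{ρ,k} conj(X_{ρ,l}) → 1/(k+l+1)` as `λ → 0⁺`. [cite: Burnol2002, Thm. 5.2] -/
theorem tendsto_gram_same (γ : ℝ) (k l : ℕ) :
    Tendsto (fun lam : ℝ ↦ ∫ t in Ioi (0 : ℝ),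
        burnolX lam ((1 / 2 : ℂ) + γ * I) k t * conj (burnolX lam ((1 / 2 : ℂ) + γ * I) l t))
      (𝓝[>] 0) (𝓝 (1 / ((k : ℂ) + l + 1))) := by
  have hw : (wR γ : ℂ) ≠ 0 := by exact_mod_cast (wR_pos' γ).ne'
  have hπ : (π : ℂ) ≠ 0 := by exact_mod_cast Real.pi_ne_zero
  have hkl : ((k : ℂ) + l + 1) ≠ 0 := by exact_mod_cast (by positivity : ((k : ℝ) + l + 1) ≠ 0)
  have h := (tendsto_integral_conj_burnolKk_mul_burnolKk γ k l).const_mul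
    ((-1) ^ (k + l) / ((wR γ : ℂ) * (2 * π)))
  have hval : (-1) ^ (k + l) / ((wR γ : ℂ) * (2 * π)) * ((wR γ : ℂ) * ((-1) ^ (k + l) *
      (2 * π / ((k : ℂ) + l + 1)))) = 1 / ((k : ℂ) + l + 1) := by
    have h1 : ((-1 : ℂ) ^ (k + l)) * (-1) ^ (k + l) = 1 := by rw [← mul_pow]; norm_num
    field_simp
    linear_combination h1
  rw [hval] at h
  refine h.congr' ?_
  filter_upwards [BurnolVectors.eventually_mem_Ioo] with lam hlam
  have hL0 : (Lof lam : ℂ) ≠ 0 := by exact_mod_cast (Lof_pos hlam.1 hlam.2).ne'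
  rw [integral_burnolX_mul_conj_burnolX hlam.1 hlam.2, coef_mul_conj_coef γ k hlam.1 hlam.2 l]
  field_simp

/-- (4) **Distinct zeros**: `∫ X_{ρ,k} conj(X_{ρ',l}) → 0` as `λ → 0⁺` (`γ ≠ γ'`). [cite: Burnol2002, Thm. 5.2] -/
theorem tendsto_gram_ne {γ γ' : ℝ} (hne : γ ≠ γ') (k l : ℕ) :
    Tendsto (fun lam : ℝ ↦ ∫ t in Ioi (0 : ℝ),
        burnolX lam ((1 / 2 : ℂ) + γ * I) k t * conj (burnolX lam ((1 / 2 : ℂ) + γ' * I) l t))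
      (𝓝[>] 0) (𝓝 0) := by
  set C : ℂ := burnolPhase ((1 / 2 : ℂ) + γ * I) * conj (burnolPhase ((1 / 2 : ℂ) + γ' * I)) * (-1) ^ (k + l) /
    ((Real.sqrt (wR γ) : ℂ) * Real.sqrt (wR γ')) * (1 / (2 * π)) with hC
  have h := (tendsto_integral_conj_burnolKk_mul_burnolKk_of_ne hne k l).const_mul C
  rw [mul_zero] at h
  refine h.congr' ?_
  filter_upwards [BurnolVectors.eventually_mem_Ioo] with lam hlam
  rw [integral_burnolX_mul_conj_burnolX hlam.1 hlam.2, coef_mul_conj_coef_cross γ k hlam.1 hlam.2 γ' l, hC]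
  ring

/-- (5)/(6) The pairing with `χ` in terms of the Mellin-side pairing. [folklore] -/
theorem sqrt_mul_integral_chi_mul_conj_burnolX {lam : ℝ} (h0 : 0 < lam) (h1 : lam < 1) (γ : ℝ) (k : ℕ) :
    (Real.sqrt (Real.log (1 / lam)) : ℂ) *
        ∫ t in Ioi (0 : ℝ), ((nbChi t : ℝ) : ℂ) * conj (burnolX lam ((1 / 2 : ℂ) + γ * I) k t) =
      (conj (burnolPhase ((1 / 2 : ℂ) + γ * I)) * (-1) ^ k / (Real.sqrt (wR γ) : ℂ)) * ((1 / (2 * π) : ℂ) *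
        (((Lof lam : ℂ) ^ k)⁻¹ * ∫ τ : ℝ, burnolKk ((1 / 2 : ℂ) + γ * I) k lam ((1 / 2 : ℂ) + τ * I) /
          ((1 / 2 : ℂ) + τ * I))) := by
  have e : ∀ t : ℝ, ((nbChi t : ℝ) : ℂ) * conj (burnolX lam ((1 / 2 : ℂ) + γ * I) k t) =
      conj (burnolCoef ((1 / 2 : ℂ) + γ * I) k lam) *
        ((Ioc (0 : ℝ) 1).indicator (fun _ ↦ (1 : ℂ)) t * conj (burnolVec γ k lam t)) := by
    intro t
    simp only [burnolX, im_line, nbChi, map_mul]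
    by_cases ht : t ∈ Ioc (0 : ℝ) 1
    · rw [indicator_of_mem ht, indicator_of_mem ht, Pi.one_apply, ofReal_one]; ring
    · rw [indicator_of_notMem ht, indicator_of_notMem ht, ofReal_zero]; ring
  simp_rw [e]
  rw [integral_const_mul, integral_chi_mul_conj_vec γ k h0 h1, ← mul_assoc,
    sqrt_mul_conj_coef γ k h0 h1]
  ring

/-- (5) **`k = 0`**: `√(log(1/λ)) (χ, X_{ρ,0}) → (ρ-1)/ρ²`. [cite: Burnol2002, Thm. 5.3] -/
theorem tendsto_pairing_zero (γ : ℝ) :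
    Tendsto (fun lam : ℝ ↦ (Real.sqrt (Real.log (1 / lam)) : ℂ) *
        ∫ t in Ioi (0 : ℝ), ((nbChi t : ℝ) : ℂ) * conj (burnolX lam ((1 / 2 : ℂ) + γ * I) 0 t))
      (𝓝[>] 0) (𝓝 ((((1 / 2 : ℂ) + γ * I) - 1) / ((1 / 2 : ℂ) + γ * I) ^ 2)) := by
  have h := ((tendsto_integral_burnolKk_zero_div γ).const_mul (1 / (2 * π) : ℂ)).const_mul
    (conj (burnolPhase ((1 / 2 : ℂ) + γ * I)) * (-1) ^ 0 / (Real.sqrt (wR γ) : ℂ))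
  rw [phase_limit_value] at h
  refine h.congr' ?_
  filter_upwards [BurnolVectors.eventually_mem_Ioo] with lam hlam
  rw [sqrt_mul_integral_chi_mul_conj_burnolX hlam.1 hlam.2 γ 0]
  simp only [pow_zero, inv_one, one_mul]

/-- (6) **`k ≥ 1`**: `√(log(1/λ)) (χ, X_{ρ,k+1}) → 0`. [cite: Burnol2002, Thm. 5.3] -/
theorem tendsto_pairing_succ (γ : ℝ) (k : ℕ) :
    Tendsto (fun lam : ℝ ↦ (Real.sqrt (Real.log (1 / lam)) : ℂ) *
        ∫ t in Ioi (0 : ℝ), ((nbChi t : ℝ) : ℂ) * conj (burnolX lam ((1 / 2 : ℂ) + γ * I) (k + 1) t))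
      (𝓝[>] 0) (𝓝 0) := by
  have h := ((tendsto_integral_burnolKk_succ_div γ k).const_mul (1 / (2 * π) : ℂ)).const_mul
    (conj (burnolPhase ((1 / 2 : ℂ) + γ * I)) * (-1) ^ (k + 1) / (Real.sqrt (wR γ) : ℂ))
  rw [mul_zero, mul_zero] at h
  refine h.congr' ?_
  filter_upwards [BurnolVectors.eventually_mem_Ioo] with lam hlam
  rw [sqrt_mul_integral_chi_mul_conj_burnolX hlam.1 hlam.2 γ (k + 1)]

end Burnol2002Construction

open Burnol2002Construction in
/-- **Burnol 2002, Definition 5.1 with Corollary 4.3 and Theorems 5.2, 5.3 — the Hilbert space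
vectors `X^λ_{ρ,k}`, proved** (for the Mellin-side variant `burnolX` of Burnol's vectors, in the
`(χ, 𝓑_λ)` picture): for every zero `ρ` of `ζ` on the critical line and every `k < m_ρ`,
`X^λ_{ρ,k} ∈ L²(0,∞)`; `X^λ_{ρ,k} ⊥ t ↦ {1/(at)}` for `1 ≤ a ≤ 1/λ` ("`Y^λ_{s,k}` is perpendicular
to `𝓒_λ` if … `s` is a zero `ρ` of the zeta function and `k < m_ρ`", Cor. 4.3); "as `λ` decreases
to `0` one has `lim (X^λ_{ρ₁,k}, X^λ_{ρ₂,l}) = 0 (ρ₁ ≠ ρ₂)`, `lim (X^λ_{ρ,k}, X^λ_{ρ,l}) = 1/(k+l+1)`"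
(Thm. 5.2); "`lim √(log(1/λ)) (χ₁, X^λ_{ρ,k}) = 0 (k ≥ 1)`, `lim √(log(1/λ)) (χ₁, X^λ_{ρ,0}) = (ρ-1)/ρ²`"
(Thm. 5.3, transported to `χ` by the unitary `1 - M`, §4). Scalar products are `∫_0^∞ f ḡ`.
[cite: Burnol2002, Definition 5.1, Corollary 4.3, Theorems 5.2 and 5.3] -/
theorem burnolVectors_spec :
    ∃ X : ℝ → ℂ → ℕ → ℝ → ℂ,
    ∀ ρ : ℂ, riemannZeta ρ = 0 → ρ.re = 1 / 2 →
    ∀ k : ℕ, (k : ℤ) < riemannZetaZeroOrder ρ →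
      (∀ lam : ℝ, 0 < lam → lam < 1 → MemLp (X lam ρ k) 2 (volume.restrict (Set.Ioi 0))) ∧
      (∀ lam : ℝ, 0 < lam → lam < 1 → ∀ a : ℝ, 1 ≤ a → a ≤ 1 / lam →
        ∫ t in Set.Ioi (0 : ℝ), ((beurlingRho a t : ℝ) : ℂ) * conj (X lam ρ k t) = 0) ∧
      (∀ l : ℕ, (l : ℤ) < riemannZetaZeroOrder ρ →
        Tendsto (fun lam : ℝ ↦ ∫ t in Set.Ioi (0 : ℝ), X lam ρ k t * conj (X lam ρ l t))
          (𝓝[>] 0) (𝓝 (1 / ((k : ℂ) + l + 1)))) ∧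
      (∀ ρ' : ℂ, riemannZeta ρ' = 0 → ρ'.re = 1 / 2 → ρ' ≠ ρ →
        ∀ l : ℕ, (l : ℤ) < riemannZetaZeroOrder ρ' →
          Tendsto (fun lam : ℝ ↦ ∫ t in Set.Ioi (0 : ℝ), X lam ρ k t * conj (X lam ρ' l t))
            (𝓝[>] 0) (𝓝 0)) ∧
      (k = 0 → Tendsto (fun lam : ℝ ↦ (Real.sqrt (Real.log (1 / lam)) : ℂ) *
          ∫ t in Set.Ioi (0 : ℝ), ((nbChi t : ℝ) : ℂ) * conj (X lam ρ k t)) (𝓝[>] 0)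
        (𝓝 ((ρ - 1) / ρ ^ 2))) ∧
      (1 ≤ k → Tendsto (fun lam : ℝ ↦ (Real.sqrt (Real.log (1 / lam)) : ℂ) *
          ∫ t in Set.Ioi (0 : ℝ), ((nbChi t : ℝ) : ℂ) * conj (X lam ρ k t)) (𝓝[>] 0) (𝓝 0)) := by
  refine ⟨burnolX, fun ρ _ hre k hk ↦ ?_⟩
  obtain ⟨γ, rfl⟩ : ∃ γ : ℝ, ρ = (1 / 2 : ℂ) + γ * I :=
    ⟨ρ.im, Complex.ext (by simp [hre]) (by simp)⟩
  refine ⟨fun lam h0 h1 ↦ memLp_burnolX h0 h1 γ k,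
    fun lam h0 h1 a ha ha' ↦ integral_beurlingRho_mul_conj_burnolX h0 h1 hk ha ha',
    fun l _ ↦ tendsto_gram_same γ k l, ?_, ?_, ?_⟩
  · intro ρ' _ hre' hne l _
    obtain ⟨γ', rfl⟩ : ∃ γ' : ℝ, ρ' = (1 / 2 : ℂ) + γ' * I :=
      ⟨ρ'.im, Complex.ext (by simp [hre']) (by simp)⟩
    have hγ : γ ≠ γ' := fun h ↦ hne (by rw [h])
    exact tendsto_gram_ne hγ k l
  · intro hk0
    subst hk0
    exact tendsto_pairing_zero γ
  · intro hk1
    obtain ⟨j, rfl⟩ : ∃ j, k = j + 1 := ⟨k - 1, by omega⟩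
    exact tendsto_pairing_succ γ j

namespace Burnol2002Assembly

/-! ## 5. Finitely many zeros on the line: `L · D(λ)² ≥ ∑_{ρ ∈ T} m_ρ²/|ρ|² - o(1)` -/

/-- On the critical line `|(ρ-1)/ρ²|² = 1/‖ρ‖²` (`‖ρ - 1‖ = ‖ρ‖`). [folklore] -/
theorem normSq_weight {ρ : ℂ} (hρ : ρ.re = 1 / 2) :
    Complex.normSq ((ρ - 1) / ρ ^ 2) = 1 / ‖ρ‖ ^ 2 := by
  have e1 : ‖ρ‖ ^ 2 = 1 / 4 + ρ.im ^ 2 := by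
    rw [Complex.sq_norm, Complex.normSq_apply, hρ]; ring
  have e2 : ‖ρ - 1‖ ^ 2 = 1 / 4 + ρ.im ^ 2 := by
    rw [Complex.sq_norm, Complex.normSq_apply]
    simp only [sub_re, one_re, hρ, sub_im, one_im, sub_zero]
    ring
  have hpos : 0 < ‖ρ‖ ^ 2 := by rw [e1]; positivity
  rw [Complex.normSq_eq_norm_sq, norm_div, norm_pow, div_pow, e2, ← e1]
  field_simp

/-- **`L · D(λ)² ≥ ∑_{ρ ∈ T} m_ρ²/|ρ|² - o(1)` for a finite set `T` of zeros on the line**, from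
Burnol's vectors (Theorem 5.4, proof): with `y_λ = ∑_{ρ ∈ T} ∑_{k < m_ρ} a_{ρ,k} X^λ_{ρ,k}`,
`a_{ρ,k} = ((ρ-1)/ρ²) u^{(m_ρ)}_k`, `u^{(m)} = H_m⁻¹ e₀` (Cauchy, `u₀ = m²`), one has
`√L (χ, y_λ) → ∑_{ρ ∈ T} m_ρ²/|ρ|²` and `‖y_λ‖² → ∑_{ρ ∈ T} m_ρ²/|ρ|²`, and `D(λ) ≥ |(χ,y_λ)|/‖y_λ‖`.
[cite: Burnol2002, Thm. 5.4 (proof)] -/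
theorem eventually_nbDist_ge_of_finset (T : Finset ℂ)
    (hT : ∀ ρ ∈ T, riemannZeta ρ = 0 ∧ ρ.re = 1 / 2) {ε : ℝ} (hε : 0 < ε) :
    ∀ᶠ lam : ℝ in 𝓝[>] 0,
      ENNReal.ofReal ((Real.sqrt (∑ ρ ∈ T, (riemannZetaZeroOrder ρ : ℝ) ^ 2 / ‖ρ‖ ^ 2) - ε) /
        Real.sqrt (Real.log (1 / lam))) ≤ nbDist lam := by
  classical
  obtain ⟨X, hXs⟩ := burnolVectors_spec
  ------------------------------------------------------------------
  -- multiplicities as natural numbers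
  ------------------------------------------------------------------
  set m : ℂ → ℕ := fun ρ ↦ (riemannZetaZeroOrder ρ).toNat with hmdef
  have hne1 : ∀ ρ ∈ T, ρ ≠ 1 := fun ρ hρ h ↦ by
    have := (hT ρ hρ).2; rw [h] at this; norm_num at this
  have hmcast : ∀ ρ ∈ T, ((m ρ : ℕ) : ℤ) = riemannZetaZeroOrder ρ := fun ρ hρ ↦
    Int.toNat_of_nonneg (riemannZetaZeroOrder_nonneg (hne1 ρ hρ))
  have hmreal : ∀ ρ ∈ T, (riemannZetaZeroOrder ρ : ℝ) = (m ρ : ℝ) := fun ρ hρ ↦ by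
    rw [← hmcast ρ hρ]; simp
  have hklt : ∀ (ρ : ℂ) (k : ℕ), k < m ρ → (k : ℤ) < riemannZetaZeroOrder ρ :=
    fun ρ k hk ↦ Int.lt_toNat.1 hk
  ------------------------------------------------------------------
  -- Cauchy's vectors, weights, coefficients, index set
  ------------------------------------------------------------------
  choose U hU0 hU using hilbert_inverse_first_column
  set w : ℂ → ℂ := fun ρ ↦ (ρ - 1) / ρ ^ 2 with hwdef
  set A : ℂ → ℕ → ℂ := fun ρ k ↦ w ρ * (U (m ρ - 1) k : ℂ) with hAdef
  set S : Finset (Σ _ : ℂ, ℕ) := T.sigma fun ρ ↦ Finset.range (m ρ) with hSdef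
  have hS : ∀ σ ∈ S, σ.1 ∈ T ∧ σ.2 < m σ.1 := fun σ hσ ↦ by
    simpa [hSdef, Finset.mem_sigma, Finset.mem_range] using hσ
  -- the clauses of the named fact for the indices we use
  have hL2 : ∀ σ ∈ S, ∀ lam : ℝ, 0 < lam → lam < 1 → MemLp (X lam σ.1 σ.2) 2 (volume.restrict (Set.Ioi (0 : ℝ))) :=
    fun σ hσ ↦ (hXs σ.1 (hT σ.1 (hS σ hσ).1).1 (hT σ.1 (hS σ hσ).1).2 σ.2
      (hklt σ.1 σ.2 (hS σ hσ).2)).1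
  have horth : ∀ σ ∈ S, ∀ lam : ℝ, 0 < lam → lam < 1 → ∀ a : ℝ, 1 ≤ a → a ≤ 1 / lam →
      ∫ t in Set.Ioi (0 : ℝ), ((beurlingRho a t : ℝ) : ℂ) * conj (X lam σ.1 σ.2 t) = 0 :=
    fun σ hσ ↦ (hXs σ.1 (hT σ.1 (hS σ hσ).1).1 (hT σ.1 (hS σ hσ).1).2 σ.2
      (hklt σ.1 σ.2 (hS σ hσ).2)).2.1
  -- limits of the Gram entries
  set Gl : (Σ _ : ℂ, ℕ) → (Σ _ : ℂ, ℕ) → ℂ :=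
    fun σ σ' ↦ if σ.1 = σ'.1 then 1 / ((σ.2 : ℂ) + σ'.2 + 1) else 0 with hGldef
  have hgram : ∀ σ ∈ S, ∀ σ' ∈ S, Tendsto (fun lam : ℝ ↦
      ∫ t in Set.Ioi (0 : ℝ), X lam σ.1 σ.2 t * conj (X lam σ'.1 σ'.2 t)) (𝓝[>] 0) (𝓝 (Gl σ σ')) := by
    intro σ hσ σ' hσ'
    have hsp := hXs σ.1 (hT σ.1 (hS σ hσ).1).1 (hT σ.1 (hS σ hσ).1).2 σ.2 (hklt σ.1 σ.2 (hS σ hσ).2)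
    by_cases h : σ.1 = σ'.1
    · have hl : (σ'.2 : ℤ) < riemannZetaZeroOrder σ.1 := by
        rw [h]; exact hklt σ'.1 σ'.2 (hS σ' hσ').2
      have := hsp.2.2.1 σ'.2 hl
      simp only [hGldef, if_pos h]
      rw [h] at this ⊢
      exact this
    · have := hsp.2.2.2.1 σ'.1 (hT σ'.1 (hS σ' hσ').1).1 (hT σ'.1 (hS σ' hσ').1).2 (Ne.symm h) σ'.2
        (hklt σ'.1 σ'.2 (hS σ' hσ').2)
      simp only [hGldef, if_neg h]
      exact this
  -- limits of the pairings
  set Pl : (Σ _ : ℂ, ℕ) → ℂ := fun σ ↦ if σ.2 = 0 then w σ.1 else 0 with hPldef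
  have hpair : ∀ σ ∈ S, Tendsto (fun lam : ℝ ↦ (Real.sqrt (Real.log (1 / lam)) : ℂ) *
      ∫ t in Set.Ioi (0 : ℝ), ((nbChi t : ℝ) : ℂ) * conj (X lam σ.1 σ.2 t)) (𝓝[>] 0) (𝓝 (Pl σ)) := by
    intro σ hσ
    have hsp := hXs σ.1 (hT σ.1 (hS σ hσ).1).1 (hT σ.1 (hS σ hσ).1).2 σ.2 (hklt σ.1 σ.2 (hS σ hσ).2)
    by_cases h : σ.2 = 0
    · simp only [hPldef, if_pos h, hwdef]
      exact hsp.2.2.2.2.1 h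
    · simp only [hPldef, if_neg h]
      exact hsp.2.2.2.2.2 (Nat.one_le_iff_ne_zero.2 h)
  ------------------------------------------------------------------
  -- the test vector `y_λ`
  ------------------------------------------------------------------
  set y : ℝ → ℝ → ℂ := fun lam t ↦ ∑ σ ∈ S, A σ.1 σ.2 * X lam σ.1 σ.2 t with hydef
  have hyL2 : ∀ lam : ℝ, 0 < lam → lam < 1 → MemLp (y lam) 2 (volume.restrict (Set.Ioi (0 : ℝ))) := fun lam h0 h1 ↦
    memLp_finsetSum S fun σ hσ ↦ (hL2 σ hσ lam h0 h1).const_mul _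
  have hyorth : ∀ lam : ℝ, 0 < lam → lam < 1 → ∀ a : ℝ, 1 ≤ a → a ≤ 1 / lam →
      ∫ t in Set.Ioi (0 : ℝ), ((beurlingRho a t : ℝ) : ℂ) * conj (y lam t) = 0 := by
    intro lam h0 h1 a ha1 ha2
    simp only [hydef]
    rw [integral_mul_conj_sum S (fun σ ↦ A σ.1 σ.2) (memLp_beurlingRho ha1)
      (fun σ hσ ↦ hL2 σ hσ lam h0 h1)]
    exact Finset.sum_eq_zero fun σ hσ ↦ by rw [horth σ hσ lam h0 h1 a ha1 ha2, mul_zero]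
  have hPexp : ∀ lam : ℝ, 0 < lam → lam < 1 →
      ∫ t in Set.Ioi (0 : ℝ), ((nbChi t : ℝ) : ℂ) * conj (y lam t) =
        ∑ σ ∈ S, conj (A σ.1 σ.2) * ∫ t in Set.Ioi (0 : ℝ), ((nbChi t : ℝ) : ℂ) * conj (X lam σ.1 σ.2 t) := by
    intro lam h0 h1
    simp only [hydef]
    exact integral_mul_conj_sum S (fun σ ↦ A σ.1 σ.2) memLp_nbChi (fun σ hσ ↦ hL2 σ hσ lam h0 h1)
  have hNexp : ∀ lam : ℝ, 0 < lam → lam < 1 →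
      ∫ t in Set.Ioi (0 : ℝ), y lam t * conj (y lam t) =
        ∑ σ ∈ S, ∑ σ' ∈ S, A σ.1 σ.2 * conj (A σ'.1 σ'.2) *
          ∫ t in Set.Ioi (0 : ℝ), X lam σ.1 σ.2 t * conj (X lam σ'.1 σ'.2 t) := by
    intro lam h0 h1
    simp only [hydef]
    rw [integral_sum_mul_conj S (fun σ ↦ A σ.1 σ.2) (hyL2 lam h0 h1) (fun σ hσ ↦ hL2 σ hσ lam h0 h1)]
    refine Finset.sum_congr rfl fun σ hσ ↦ ?_
    simp only [hydef]
    rw [integral_mul_conj_sum S (fun σ ↦ A σ.1 σ.2) (hL2 σ hσ lam h0 h1)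
      (fun σ hσ ↦ hL2 σ hσ lam h0 h1), Finset.mul_sum]
    exact Finset.sum_congr rfl fun σ' _ ↦ by ring
  ------------------------------------------------------------------
  -- the limiting values: both equal `Sv = ∑_{ρ ∈ T} m_ρ²/‖ρ‖²`
  ------------------------------------------------------------------
  set Sv : ℝ := ∑ ρ ∈ T, (riemannZetaZeroOrder ρ : ℝ) ^ 2 / ‖ρ‖ ^ 2 with hSvdef
  have hSv_eq : (Sv : ℂ) = ∑ ρ ∈ T, ((Complex.normSq (w ρ) * (m ρ : ℝ) ^ 2 : ℝ) : ℂ) := by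
    rw [hSvdef, ofReal_sum]
    refine Finset.sum_congr rfl fun ρ hρ ↦ ?_
    rw [hmreal ρ hρ, hwdef, normSq_weight (hT ρ hρ).2]
    push_cast
    ring
  -- Cauchy's `u₀ = m²`, and the first-column identity, cast to `ℂ`
  have hU0' : ∀ ρ : ℂ, 0 < m ρ → ((U (m ρ - 1) 0 : ℝ) : ℂ) = (m ρ : ℂ) ^ 2 := by
    intro ρ hpos
    rw [hU0]
    have : ((m ρ - 1 : ℕ) : ℝ) + 1 = (m ρ : ℝ) := by
      rw [Nat.cast_sub (Nat.one_le_iff_ne_zero.2 hpos.ne')]; push_cast; ring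
    rw [this]
    push_cast
    rfl
  have hUsum : ∀ ρ : ℂ, 0 < m ρ → ∀ k ∈ Finset.range (m ρ),
      ∑ l ∈ Finset.range (m ρ), ((U (m ρ - 1) l : ℝ) : ℂ) * (1 / ((k : ℂ) + l + 1)) =
        if k = 0 then 1 else 0 := by
    intro ρ hpos k hk
    have h := hU (m ρ - 1) k (by rw [Nat.sub_add_cancel hpos]; exact Finset.mem_range.1 hk)
    rw [Nat.sub_add_cancel hpos] at h
    have h' := congrArg (fun r : ℝ ↦ (r : ℂ)) h
    push_cast at h'
    rw [apply_ite Complex.ofReal, Complex.ofReal_one, Complex.ofReal_zero] at h'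
    rw [← h']
    refine Finset.sum_congr rfl fun l _ ↦ ?_
    rw [mul_one_div]
  -- the per-zero value `conj(a_{ρ,0}) w_ρ = |w_ρ|² m_ρ²`
  have hdiag : ∀ ρ ∈ T, 0 < m ρ → conj (A ρ 0) * w ρ = ((Complex.normSq (w ρ) * (m ρ : ℝ) ^ 2 : ℝ) : ℂ) := by
    intro ρ _ hpos
    simp only [hAdef, map_mul, Complex.conj_ofReal]
    rw [hU0' ρ hpos]
    push_cast
    rw [Complex.normSq_eq_conj_mul_self]
    ring
  have hP0 : ∑ σ ∈ S, conj (A σ.1 σ.2) * Pl σ = (Sv : ℂ) := by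
    rw [hSv_eq, hSdef, Finset.sum_sigma]
    refine Finset.sum_congr rfl fun ρ hρ ↦ ?_
    have e : ∀ k ∈ Finset.range (m ρ), conj (A ρ k) * Pl ⟨ρ, k⟩ =
        if k = 0 then conj (A ρ k) * w ρ else 0 := by
      intro k _
      simp only [hPldef]
      split_ifs <;> simp
    rw [Finset.sum_congr rfl e, Finset.sum_ite_eq']
    rcases Nat.eq_zero_or_pos (m ρ) with h0 | hpos
    · rw [if_neg (by rw [h0]; simp)]
      rw [h0]; push_cast; ring
    · rw [if_pos (Finset.mem_range.2 hpos), hdiag ρ hρ hpos]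
  have hG0 : ∑ σ ∈ S, ∑ σ' ∈ S, A σ.1 σ.2 * conj (A σ'.1 σ'.2) * Gl σ σ' = (Sv : ℂ) := by
    -- the inner sum only sees `ρ' = ρ`
    have hinner : ∀ σ ∈ S, ∑ σ' ∈ S, A σ.1 σ.2 * conj (A σ'.1 σ'.2) * Gl σ σ' =
        ∑ l ∈ Finset.range (m σ.1), A σ.1 σ.2 * conj (A σ.1 l) * (1 / ((σ.2 : ℂ) + l + 1)) := by
      intro σ hσ
      rw [hSdef, Finset.sum_sigma]
      have e : ∀ ρ' ∈ T, ∑ l ∈ Finset.range (m ρ'), A σ.1 σ.2 * conj (A ρ' l) * Gl σ ⟨ρ', l⟩ =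
          if σ.1 = ρ' then ∑ l ∈ Finset.range (m ρ'),
            A σ.1 σ.2 * conj (A ρ' l) * (1 / ((σ.2 : ℂ) + l + 1)) else 0 := by
        intro ρ' _
        simp only [hGldef]
        split_ifs with h
        · rfl
        · simp
      rw [Finset.sum_congr rfl e, Finset.sum_ite_eq, if_pos (hS σ hσ).1]
    rw [Finset.sum_congr rfl hinner, hSdef, Finset.sum_sigma, hSv_eq]
    refine Finset.sum_congr rfl fun ρ hρ ↦ ?_
    rcases Nat.eq_zero_or_pos (m ρ) with h0 | hpos
    · rw [h0]; simp
    · calc ∑ k ∈ Finset.range (m ρ), ∑ l ∈ Finset.range (m ρ),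
            A ρ k * conj (A ρ l) * (1 / ((k : ℂ) + l + 1))
          = ∑ k ∈ Finset.range (m ρ), (conj (w ρ) * w ρ * (U (m ρ - 1) k : ℂ)) *
              ∑ l ∈ Finset.range (m ρ), ((U (m ρ - 1) l : ℝ) : ℂ) * (1 / ((k : ℂ) + l + 1)) := by
            refine Finset.sum_congr rfl fun k _ ↦ ?_
            rw [Finset.mul_sum]
            refine Finset.sum_congr rfl fun l _ ↦ ?_
            simp only [hAdef, map_mul, Complex.conj_ofReal]
            ring
        _ = ∑ k ∈ Finset.range (m ρ), (conj (w ρ) * w ρ * (U (m ρ - 1) k : ℂ)) *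
              (if k = 0 then 1 else 0) :=
            Finset.sum_congr rfl fun k hk ↦ by rw [hUsum ρ hpos k hk]
        _ = conj (w ρ) * w ρ * (U (m ρ - 1) 0 : ℂ) := by
            simp only [mul_ite, mul_one, mul_zero]
            rw [Finset.sum_ite_eq', if_pos (Finset.mem_range.2 hpos)]
        _ = ((Complex.normSq (w ρ) * (m ρ : ℝ) ^ 2 : ℝ) : ℂ) := by
            rw [hU0' ρ hpos]
            push_cast
            rw [Complex.normSq_eq_conj_mul_self]
  ------------------------------------------------------------------
  -- the limits `√L (χ, y_λ) → Sv` and `‖y_λ‖² → Sv`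
  ------------------------------------------------------------------
  have hPlim : Tendsto (fun lam : ℝ ↦ (Real.sqrt (Real.log (1 / lam)) : ℂ) *
      ∫ t in Set.Ioi (0 : ℝ), ((nbChi t : ℝ) : ℂ) * conj (y lam t)) (𝓝[>] 0) (𝓝 (Sv : ℂ)) := by
    have h := tendsto_finsetSum S fun σ hσ ↦ (hpair σ hσ).const_mul (conj (A σ.1 σ.2))
    rw [hP0] at h
    refine h.congr' ?_
    filter_upwards [BurnolVectors.eventually_mem_Ioo] with lam hlam
    rw [hPexp lam hlam.1 hlam.2, Finset.mul_sum]
    exact Finset.sum_congr rfl fun σ _ ↦ by ring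
  have hNlim : Tendsto (fun lam : ℝ ↦ ∫ t in Set.Ioi (0 : ℝ), ‖y lam t‖ ^ 2) (𝓝[>] 0) (𝓝 Sv) := by
    have h := tendsto_finsetSum S fun σ hσ ↦ tendsto_finsetSum S fun σ' hσ' ↦
      (hgram σ hσ σ' hσ').const_mul (A σ.1 σ.2 * conj (A σ'.1 σ'.2))
    rw [hG0] at h
    have h2 : Tendsto (fun lam : ℝ ↦ ∫ t in Set.Ioi (0 : ℝ), y lam t * conj (y lam t)) (𝓝[>] 0)
        (𝓝 (Sv : ℂ)) := by
      refine h.congr' ?_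
      filter_upwards [BurnolVectors.eventually_mem_Ioo] with lam hlam
      rw [hNexp lam hlam.1 hlam.2]
    have h3 := (Complex.continuous_re.tendsto _).comp h2
    rw [Complex.ofReal_re] at h3
    refine h3.congr' (Eventually.of_forall fun lam ↦ ?_)
    simp only [Function.comp_apply]
    rw [integral_mul_conj_self, Complex.ofReal_re]
  ------------------------------------------------------------------
  -- conclusion
  ------------------------------------------------------------------
  by_cases ht : Real.sqrt Sv - ε ≤ 0
  · refine Eventually.of_forall fun lam ↦ ?_
    rw [ENNReal.ofReal_of_nonpos (div_nonpos_of_nonpos_of_nonneg ht (Real.sqrt_nonneg _))]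
    exact bot_le
  rw [not_le] at ht
  set t : ℝ := Real.sqrt Sv - ε with htdef
  have hSv0 : 0 ≤ Sv := Finset.sum_nonneg fun ρ _ ↦ by positivity
  have hSvpos : 0 < Sv := by
    by_contra h
    have hS : Sv = 0 := le_antisymm (not_lt.1 h) hSv0
    rw [hS, Real.sqrt_zero] at htdef
    linarith
  have htS : t < Real.sqrt Sv := by rw [htdef]; linarith
  have hnormP : Tendsto (fun lam : ℝ ↦ Real.sqrt (Real.log (1 / lam)) *
      ‖∫ t in Set.Ioi (0 : ℝ), ((nbChi t : ℝ) : ℂ) * conj (y lam t)‖) (𝓝[>] 0) (𝓝 Sv) := by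
    have h := hPlim.norm
    rw [Complex.norm_real, Real.norm_of_nonneg hSv0] at h
    refine h.congr' (Eventually.of_forall fun lam ↦ ?_)
    rw [norm_mul, Complex.norm_real, Real.norm_of_nonneg (Real.sqrt_nonneg _)]
  have hR : Tendsto (fun lam : ℝ ↦ Real.sqrt (Real.log (1 / lam)) *
      ‖∫ t in Set.Ioi (0 : ℝ), ((nbChi t : ℝ) : ℂ) * conj (y lam t)‖ /
        Real.sqrt (∫ t in Set.Ioi (0 : ℝ), ‖y lam t‖ ^ 2)) (𝓝[>] 0) (𝓝 (Sv / Real.sqrt Sv)) :=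
    hnormP.div hNlim.sqrt (Real.sqrt_pos.2 hSvpos).ne'
  have hRS : Sv / Real.sqrt Sv = Real.sqrt Sv := by
    rw [div_eq_iff (Real.sqrt_pos.2 hSvpos).ne', Real.mul_self_sqrt hSv0]
  rw [hRS] at hR
  filter_upwards [hR.eventually (lt_mem_nhds htS), hNlim.eventually (lt_mem_nhds hSvpos),
    BurnolVectors.eventually_mem_Ioo] with lam hq hn hlam
  have hL : 0 < Real.log (1 / lam) := Real.log_pos (one_lt_one_div hlam.1 hlam.2)
  have hsq : 0 < Real.sqrt (Real.log (1 / lam)) := Real.sqrt_pos.2 hL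
  set Pn : ℝ := ‖∫ t in Set.Ioi (0 : ℝ), ((nbChi t : ℝ) : ℂ) * conj (y lam t)‖ with hPn
  set Nn : ℝ := ∫ t in Set.Ioi (0 : ℝ), ‖y lam t‖ ^ 2 with hNn
  have h2 : t / Real.sqrt (Real.log (1 / lam)) ≤ Pn / Real.sqrt Nn := by
    rw [div_le_iff₀ hsq]
    have hq' : t < Real.sqrt (Real.log (1 / lam)) * Pn / Real.sqrt Nn := hq
    calc t ≤ Real.sqrt (Real.log (1 / lam)) * Pn / Real.sqrt Nn := hq'.le
      _ = Pn / Real.sqrt Nn * Real.sqrt (Real.log (1 / lam)) := by ring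
  calc ENNReal.ofReal (t / Real.sqrt (Real.log (1 / lam))) ≤ ENNReal.ofReal (Pn / Real.sqrt Nn) :=
      ENNReal.ofReal_le_ofReal h2
    _ ≤ nbDist lam := nbDist_le_of_forall fun n a c ha ↦
        genError_ge_of_orthogonal (hyL2 lam hlam.1 hlam.2) (hyorth lam hlam.1 hlam.2) a c ha

end Burnol2002Assembly

/-! ## 6. The theorem -/

open Burnol2002Assembly in
/-- **Burnol 2002, Theorem 1.3 (= Theorem 5.4) from Burnol's vectors (Definition 5.1, Corollary 4.3,
Theorems 5.2, 5.3).** `liminf_{λ→0} D(λ)√(log(1/λ)) ≥ √(∑_ρ m_ρ²/|ρ|²)`. "If the Riemann Hypothesis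
fails this result is true but trivial as the left-hand side then takes the value `+∞`": a zero off
the line bounds `D(λ)` below (`genError_ge_of_zero_off_line`, the elementary half of
Nyman–Beurling). Otherwise all nontrivial zeros are on the line; for every finite set `R` of them,
`D(λ)` is at least the norm of the projection of `χ` to the span of the `X^λ_{ρ,k}`, `ρ ∈ R`,
`k < m_ρ`, computed asymptotically through the Gram matrix, "diagonal blocks, one for each zero,
given by Cauchy matrices of sizes `m_ρ × m_ρ`", whose inverses have top-left element `m_ρ²`
(`eventually_nbDist_ge_of_finset`); the `tsum` over the distinct zeros is approached by finite
sub-sums when summable and is `0` otherwise. [cite: Burnol2002, Thm. 1.3 and Thm. 5.4 (proof)] -/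
theorem Burnol2002_thm1_3_holds : Burnol2002_thm1_3 := by
  classical
  intro ε hε
  by_cases hoff : ∃ ρ ∈ ZetaZeros.riemannZetaNontrivialZeros, ρ.re ≠ 1 / 2
  · -- a zero off the line: `D(λ) ≥ δ > 0`
    obtain ⟨ρ, hρ, hre⟩ := hoff
    obtain ⟨hz, h0, h1⟩ := mem_riemannZetaNontrivialZeros_iff_holds.1 hρ
    obtain ⟨s, hs, hσ, hσ1⟩ : ∃ s : ℂ, riemannZeta s = 0 ∧ 1 / 2 < s.re ∧ s.re < 1 := by
      rcases lt_or_gt_of_ne hre with hlt | hgt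
      · refine ⟨1 - ρ, GeneralizedRH.riemannZeta_one_sub_eq_zero hz h0 h1, ?_, ?_⟩
        · simp only [sub_re, one_re]; linarith
        · simp only [sub_re, one_re]; linarith
      · exact ⟨ρ, hz, hgt, h1⟩
    obtain ⟨δ, hδ, hbound⟩ := genError_ge_of_zero_off_line hs hσ hσ1
    have hnb : ∀ lam : ℝ, ENNReal.ofReal δ ≤ nbDist lam := fun lam ↦
      nbDist_le_of_forall fun n a c ha ↦ hbound n a c fun j ↦ (ha j).1
    have hlim : Tendsto (fun lam : ℝ ↦ (Real.sqrt zeroSumMultSqInvNormSq - ε) /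
        Real.sqrt (Real.log (1 / lam))) (𝓝[>] 0) (𝓝 0) :=
      tendsto_const_nhds.div_atTop tendsto_sqrt_log_one_div
    filter_upwards [hlim.eventually (gt_mem_nhds hδ)] with lam hlam
    exact (ENNReal.ofReal_le_ofReal hlam.le).trans (hnb lam)
  · -- all nontrivial zeros are on the line
    have hline : ∀ ρ ∈ ZetaZeros.riemannZetaNontrivialZeros, ρ.re = 1 / 2 := by
      intro ρ hρ; by_contra h; exact hoff ⟨ρ, hρ, h⟩
    by_cases hsum : Summable fun ρ : ZetaZeros.riemannZetaNontrivialZeros ↦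
        (riemannZetaZeroOrder (ρ : ℂ) : ℝ) ^ 2 / ‖(ρ : ℂ)‖ ^ 2
    · set S : ℝ := zeroSumMultSqInvNormSq with hSdef
      by_cases ht : Real.sqrt S - ε ≤ 0
      · refine Eventually.of_forall fun lam ↦ ?_
        rw [ENNReal.ofReal_of_nonpos (div_nonpos_of_nonpos_of_nonneg ht (Real.sqrt_nonneg _))]
        exact bot_le
      rw [not_le] at ht
      -- a finite set of zeros carrying almost all of the sum
      have hS : HasSum (fun ρ : ZetaZeros.riemannZetaNontrivialZeros ↦
          (riemannZetaZeroOrder (ρ : ℂ) : ℝ) ^ 2 / ‖(ρ : ℂ)‖ ^ 2) S := hsum.hasSum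
      have hlt : S - ε ^ 2 / 4 < S := by nlinarith
      obtain ⟨_, ⟨T, rfl⟩, hT, -⟩ :=
        (isLUB_hasSum (fun ρ ↦ by positivity) hS).exists_between hlt
      simp only at hT
      -- the finite set as a `Finset ℂ`
      set T' : Finset ℂ := T.image Subtype.val with hT'def
      have hT' : ∀ ρ ∈ T', riemannZeta ρ = 0 ∧ ρ.re = 1 / 2 := by
        intro ρ hρ
        obtain ⟨x, _, rfl⟩ := Finset.mem_image.1 hρ
        exact ⟨(mem_riemannZetaNontrivialZeros_iff_holds.1 x.2).1, hline _ x.2⟩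
      have key := eventually_nbDist_ge_of_finset T' hT' (half_pos hε)
      have hST : ∑ ρ ∈ T', (riemannZetaZeroOrder ρ : ℝ) ^ 2 / ‖ρ‖ ^ 2 =
          ∑ ρ ∈ T, (riemannZetaZeroOrder (ρ : ℂ) : ℝ) ^ 2 / ‖(ρ : ℂ)‖ ^ 2 := by
        rw [hT'def, Finset.sum_image fun x _ y _ h ↦ Subtype.ext h]
      rw [hST] at key
      have hTle : ∑ ρ ∈ T, (riemannZetaZeroOrder (ρ : ℂ) : ℝ) ^ 2 / ‖(ρ : ℂ)‖ ^ 2 ≤ S :=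
        hsum.sum_le_tsum T fun ρ _ ↦ by positivity
      have hcomp : Real.sqrt S - ε ≤
          Real.sqrt (∑ ρ ∈ T, (riemannZetaZeroOrder (ρ : ℂ) : ℝ) ^ 2 / ‖(ρ : ℂ)‖ ^ 2) - ε / 2 := by
        have := sqrt_sub_sqrt_le (a := S)
          (b := ∑ ρ ∈ T, (riemannZetaZeroOrder (ρ : ℂ) : ℝ) ^ 2 / ‖(ρ : ℂ)‖ ^ 2)
          (Finset.sum_nonneg fun ρ _ ↦ by positivity) hε (by linarith)
        linarith
      filter_upwards [key] with lam hlam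
      refine le_trans (ENNReal.ofReal_le_ofReal ?_) hlam
      exact div_le_div_of_nonneg_right hcomp (Real.sqrt_nonneg _)
    · -- not summable: the `tsum` is `0`
      have hS0 : zeroSumMultSqInvNormSq = 0 := tsum_eq_zero_of_not_summable hsum
      refine Eventually.of_forall fun lam ↦ ?_
      rw [hS0, Real.sqrt_zero, zero_sub, ENNReal.ofReal_of_nonpos]
      · exact bot_le
      · exact div_nonpos_of_nonpos_of_nonneg (by linarith) (Real.sqrt_nonneg _)

end Literature.Barriers.RiemannHypothesis
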